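import Summits.AtomisticToContinuum.BoseEinsteinCondensation.Theorems.BECConjugateDominationInfraredMinimumUncertaintyLadder

/-!
# Route `BECConjugateDomination`, crux `InfraredMinimumUncertainty` (stmt-AtomisticToContinuum-11784),
# line `fisher-gaussian-density-mode` (lead reshape r1): the core stub `stub_phaseSteinDomination` is NECESSARY

Refuter-side (drefute gen 2) bookkeeping, supports (does not close) stmt-AtomisticToContinuum-11784.
The lead's reshape r1 cut the phase stub FD (`FisherDominationV`) into `SteinIdentity`, `WeakEulerLagrange`,
`CoherenceRegular` (all three provable, two landed) and the core stub `stub_phaseSteinDomination` (PSD: FD in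
Stein / derivative-free form with a `C¹` witness field, under the crux hypotheses plus the weak Euler–Lagrange
identity and the regularity of `g`). This file kernel-checks that PSD, like FD (`fisherDomination_of_imu`), is a
CONSEQUENCE of the crux: `InfraredMinimumUncertainty → (signature of stub_phaseSteinDomination verbatim)` with
`C = 4C₀ + 4`. Hence no witness can kill the registered core stub without killing the crux itself, and the r1 cut
introduces no over-strong stub (the two remaining open stubs of the line are PSD ≍ IMU-strength and FG).

Proof: the witness is the LINEAR field `φ(z) = −λz` (`C¹`), for which the inline Stein functional is computed
directly (no Stein identity needed): `∂φ ≡ −λ`, `∂̄φ ≡ 0`, so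
`J^S(φ) = −(4/N)·Re∫(N·(−λ))|Ψ|² − λ²∫|Z|²|Ψ|² = 4λ − λ²·(N S_m)` (`steinInline_negLinearField`, using
`∫|Ψ|² = 1`); then `λ = 2/(N S_m)` (or `λ = |ν_m|` when `N S_m = 0`) exactly as in `fisherDomination_of_imu`.
The extra hypotheses of PSD (weak E–L, continuity and positivity of `g`) are not used. [folklore]
-/

noncomputable section

open MeasureTheory Filter Set
open scoped ENNReal NNReal Topology ComplexConjugate BigOperators

namespace Summit.AtomisticToContinuum.BoseEinsteinCondensation.Theorems.InfraredMinimumUncertainty.Negative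

open Literature.MathematicalPhysics.QuantumManyBody.BoseGas
open Summit.AtomisticToContinuum.BoseEinsteinCondensation.Theses.BECConjugateDomination
  (InfraredMinimumUncertainty)
open Summit.AtomisticToContinuum.BoseEinsteinCondensation.Cruxes.InfraredMinimumUncertainty.FisherGaussianDensityMode
open Summit.AtomisticToContinuum.BoseEinsteinCondensation.Theorems.StaticResponseBound.Negative
  (integral_norm_sq_eq_one)
open Summit.AtomisticToContinuum.BoseEinsteinCondensation.Theorems.CorrectorClosure.Negative
  (sideLength_succ_pos)

/-- The real Fréchet derivative of the linear field `w ↦ c·w` on `ℂ` is `v ↦ c·v`. -/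
theorem fderiv_linearField_apply (c z v : ℂ) : fderiv ℝ (fun w : ℂ => c * w) z v = c * v := by
  have h : HasFDerivAt (fun w : ℂ => c * w) (c • ContinuousLinearMap.id ℝ ℂ) z := by
    simpa using (hasFDerivAt_id (𝕜 := ℝ) z).const_mul c
  rw [h.fderiv]
  simp

/-- Wirtinger `∂` of the linear field `w ↦ c·w` is `c`. -/
theorem wirtingerD_linearField (c z : ℂ) :
    (fderiv ℝ (fun w : ℂ => c * w) z 1 - Complex.I * fderiv ℝ (fun w : ℂ => c * w) z Complex.I) / 2 = c := by
  rw [fderiv_linearField_apply, fderiv_linearField_apply]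
  linear_combination (-(c / 2)) * Complex.I_sq

/-- Wirtinger `∂̄` of the linear field `w ↦ c·w` vanishes. -/
theorem wirtingerDbar_linearField (c z : ℂ) :
    (fderiv ℝ (fun w : ℂ => c * w) z 1 + Complex.I * fderiv ℝ (fun w : ℂ => c * w) z Complex.I) / 2 = 0 := by
  rw [fderiv_linearField_apply, fderiv_linearField_apply]
  linear_combination (c / 2) * Complex.I_sq

/-- **The inline Stein functional at a linear field**: for `φ = (w ↦ −c·w)`,
`J^S_m(φ) = 4c − c²·∫|Z_m|²|Ψ|²` (every admissible state, every mode; only `∫|Ψ|² = 1` is used). -/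
theorem steinInline_negLinearField (n : ℕ) (L : ℝ) (Ψ : PeriodicTrialState (n + 1) L) (m : Fin 3 → ℤ)
    (c : ℝ) (φ : ℂ → ℂ) (hφ : ∀ z, φ z = -(c : ℂ) * z) :
    (-(4 / ((n : ℝ) + 1)) *
          (∫ X in cellN (n + 1) L,
            ((((n : ℝ) + 1 : ℝ) : ℂ) *
                ((fderiv ℝ φ (∑ j : Fin (n + 1), cellWave L m (X j)) 1 -
                    Complex.I * fderiv ℝ φ (∑ j : Fin (n + 1), cellWave L m (X j))
                      Complex.I) / 2) -
              (fderiv ℝ φ (∑ j : Fin (n + 1), cellWave L m (X j)) 1 +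
                    Complex.I * fderiv ℝ φ (∑ j : Fin (n + 1), cellWave L m (X j))
                      Complex.I) / 2 *
                starRingEnd ℂ (∑ j : Fin (n + 1), cellWave L m (X j) ^ 2)).re *
              ‖Ψ.ψ X‖ ^ 2) -
        ∫ X in cellN (n + 1) L,
          ‖φ (∑ j : Fin (n + 1), cellWave L m (X j))‖ ^ 2 * ‖Ψ.ψ X‖ ^ 2) =
      4 * c - c ^ 2 * ∫ X in cellN (n + 1) L,
        ‖∑ j : Fin (n + 1), cellWave L m (X j)‖ ^ 2 * ‖Ψ.ψ X‖ ^ 2 := by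
  have hφ' : φ = fun w : ℂ => -(c : ℂ) * w := funext hφ
  subst hφ'
  have h1 : ∀ X : Config (n + 1),
      ((((n : ℝ) + 1 : ℝ) : ℂ) *
            ((fderiv ℝ (fun w : ℂ => -(c : ℂ) * w) (∑ j : Fin (n + 1), cellWave L m (X j)) 1 -
                Complex.I * fderiv ℝ (fun w : ℂ => -(c : ℂ) * w) (∑ j : Fin (n + 1), cellWave L m (X j))
                  Complex.I) / 2) -
          (fderiv ℝ (fun w : ℂ => -(c : ℂ) * w) (∑ j : Fin (n + 1), cellWave L m (X j)) 1 +
                Complex.I * fderiv ℝ (fun w : ℂ => -(c : ℂ) * w) (∑ j : Fin (n + 1), cellWave L m (X j))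
                  Complex.I) / 2 *
            starRingEnd ℂ (∑ j : Fin (n + 1), cellWave L m (X j) ^ 2)).re * ‖Ψ.ψ X‖ ^ 2 =
        (-(((n : ℝ) + 1) * c)) * ‖Ψ.ψ X‖ ^ 2 := by
    intro X
    rw [wirtingerD_linearField, wirtingerDbar_linearField, zero_mul, sub_zero]
    congr 1
    have : ((((n : ℝ) + 1 : ℝ) : ℂ) * -(c : ℂ)) = (((-(((n : ℝ) + 1) * c)) : ℝ) : ℂ) := by
      push_cast; ring
    rw [this, Complex.ofReal_re]
  have h2 : ∀ X : Config (n + 1),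
      ‖-(c : ℂ) * ∑ j : Fin (n + 1), cellWave L m (X j)‖ ^ 2 * ‖Ψ.ψ X‖ ^ 2 =
        c ^ 2 * (‖∑ j : Fin (n + 1), cellWave L m (X j)‖ ^ 2 * ‖Ψ.ψ X‖ ^ 2) := by
    intro X
    rw [norm_mul, norm_neg, Complex.norm_real, Real.norm_eq_abs, mul_pow, sq_abs]
    ring
  simp_rw [h1, h2]
  rw [integral_const_mul, integral_const_mul, integral_norm_sq_eq_one Ψ]
  have hN : ((n : ℝ) + 1) ≠ 0 := by positivity
  field_simp

/-- **IMU ⇒ PSD** (`C = 4C₀ + 4`): the lead's core stub `stub_phaseSteinDomination` of reshape r1 (signature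
verbatim below) follows from the crux, the witness being the `C¹` linear field `−λz` with `λ = 2/(N S_m)`
(`λ = |ν_m|` if `N S_m = 0`). Unconditional; the weak Euler–Lagrange / coherence-regularity hypotheses of the stub
are not used. -/
theorem stub_phaseSteinDomination_of_imu : InfraredMinimumUncertainty →
    ∀ v : ℝ → ℝ≥0∞, IsRepulsiveFiniteRange v → (∀ r, v r ≠ ⊤) →
      ContDiff ℝ 2 (fun x : Space => (v ‖x‖).toReal) →
      (∃ Cₑ : ℝ, ∀ x : Space,
        ‖iteratedFDeriv ℝ 2 (fun x : Space => (v ‖x‖).toReal) x‖ ≤ Cₑ * Real.sqrt ((v ‖x‖).toReal)) →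
      ∃ C : ℝ, 0 ≤ C ∧ ∃ ρ₀ : ℝ, 0 < ρ₀ ∧ ∀ ρ : ℝ, 0 < ρ → ρ < ρ₀ → ∀ᶠ n : ℕ in Filter.atTop,
        ∀ Ψ : PeriodicTrialState (n + 1) (sideLength ρ (n + 1)),
          periodicEnergy v Ψ = periodicGroundStateEnergy v (n + 1) (sideLength ρ (n + 1)) →
          periodicEnergy v Ψ ≠ ⊤ → (∀ X, Ψ.ψ X = (‖Ψ.ψ X‖ : ℂ)) → (∀ X, Ψ.ψ X ≠ 0) →
          (∀ η : Config (n + 1) → ℂ, ContDiff ℝ 1 η →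
            (∀ (X : Config (n + 1)) (i : Fin (n + 1)) (k : Fin 3),
              η (X + Pi.single i (EuclideanSpace.single k (sideLength ρ (n + 1)))) = η X) →
            (∀ (σ : Equiv.Perm (Fin (n + 1))) (X : Config (n + 1)), η (X ∘ σ) = η X) →
            (∫ X in cellN (n + 1) (sideLength ρ (n + 1)),
                ((∑ i : Fin (n + 1), ∑ k : Fin 3,
                    (starRingEnd ℂ (fderiv ℝ η X (Pi.single i (EuclideanSpace.single k (1 : ℝ)))) *
                      fderiv ℝ Ψ.ψ X (Pi.single i (EuclideanSpace.single k (1 : ℝ)))).re) +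
                  (periodicInteraction v (sideLength ρ (n + 1)) X).toReal *
                    (starRingEnd ℂ (η X) * Ψ.ψ X).re)) =
              (periodicGroundStateEnergy v (n + 1) (sideLength ρ (n + 1))).toReal *
                ∫ X in cellN (n + 1) (sideLength ρ (n + 1)), (starRingEnd ℂ (η X) * Ψ.ψ X).re) →
          Continuous (fun r : Space => ∫ x in cell (sideLength ρ (n + 1)), ∫ Y in cellN n (sideLength ρ (n + 1)),
              ‖Ψ.ψ (Matrix.vecCons (x + r) Y)‖ * ‖Ψ.ψ (Matrix.vecCons x Y)‖) →
          (∀ r : Space, 0 < ∫ x in cell (sideLength ρ (n + 1)), ∫ Y in cellN n (sideLength ρ (n + 1)),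
              ‖Ψ.ψ (Matrix.vecCons (x + r) Y)‖ * ‖Ψ.ψ (Matrix.vecCons x Y)‖) →
          ∀ m : Fin 3 → ℤ, m ≠ 0 →
            ∃ φ : ℂ → ℂ, ContDiff ℝ 1 φ ∧
              16 * (cellFourierCoeff (sideLength ρ (n + 1)) (fun r : Space => ((Real.log
                (∫ x in cell (sideLength ρ (n + 1)), ∫ Y in cellN n (sideLength ρ (n + 1)),
                  ‖Ψ.ψ (Matrix.vecCons (x + r) Y)‖ * ‖Ψ.ψ (Matrix.vecCons x Y)‖) : ℝ) : ℂ)) m).re ≤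
              C * (-(4 / ((n : ℝ) + 1)) *
                    (∫ X in cellN (n + 1) (sideLength ρ (n + 1)),
                      ((((n : ℝ) + 1 : ℝ) : ℂ) *
                          ((fderiv ℝ φ (∑ j : Fin (n + 1), cellWave (sideLength ρ (n + 1)) m (X j)) 1 -
                              Complex.I * fderiv ℝ φ (∑ j : Fin (n + 1), cellWave (sideLength ρ (n + 1)) m (X j))
                                Complex.I) / 2) -
                        (fderiv ℝ φ (∑ j : Fin (n + 1), cellWave (sideLength ρ (n + 1)) m (X j)) 1 +
                              Complex.I * fderiv ℝ φ (∑ j : Fin (n + 1), cellWave (sideLength ρ (n + 1)) m (X j))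
                                Complex.I) / 2 *
                          starRingEnd ℂ (∑ j : Fin (n + 1), cellWave (sideLength ρ (n + 1)) m (X j) ^ 2)).re *
                        ‖Ψ.ψ X‖ ^ 2) -
                  ∫ X in cellN (n + 1) (sideLength ρ (n + 1)),
                    ‖φ (∑ j : Fin (n + 1), cellWave (sideLength ρ (n + 1)) m (X j))‖ ^ 2 * ‖Ψ.ψ X‖ ^ 2) := by
  intro h v hv₁ hv₂ hv₃ hv₄
  obtain ⟨C₀, hC₀, ρ₀, hρ₀, h₀⟩ := h v hv₁ hv₂ hv₃ hv₄
  refine ⟨4 * C₀ + 4, by positivity, ρ₀, hρ₀, fun ρ hρ hρ' => ?_⟩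
  filter_upwards [h₀ ρ hρ hρ'] with n hn
  intro Ψ hE hfin hreal hpos _hEL _hcont _hgpos m hm
  have himu : ((n : ℝ) + 1) * levyWeight n (sideLength ρ (n + 1)) Ψ m *
      structureFactor n (sideLength ρ (n + 1)) Ψ m ≤ C₀ := hn Ψ hE hfin hreal hpos m hm
  have hA0 : 0 ≤ ∫ X in cellN (n + 1) (sideLength ρ (n + 1)),
      ‖∑ j : Fin (n + 1), cellWave (sideLength ρ (n + 1)) m (X j)‖ ^ 2 * ‖Ψ.ψ X‖ ^ 2 :=
    integral_nonneg fun X => by positivity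
  have hNS : ((n : ℝ) + 1) * structureFactor n (sideLength ρ (n + 1)) Ψ m =
      ∫ X in cellN (n + 1) (sideLength ρ (n + 1)),
        ‖∑ j : Fin (n + 1), cellWave (sideLength ρ (n + 1)) m (X j)‖ ^ 2 * ‖Ψ.ψ X‖ ^ 2 := by
    unfold structureFactor
    rw [← mul_assoc, mul_inv_cancel₀ (by positivity), one_mul]
  have hνA : levyWeight n (sideLength ρ (n + 1)) Ψ m *
      (∫ X in cellN (n + 1) (sideLength ρ (n + 1)),
        ‖∑ j : Fin (n + 1), cellWave (sideLength ρ (n + 1)) m (X j)‖ ^ 2 * ‖Ψ.ψ X‖ ^ 2) ≤ C₀ := by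
    rw [← hNS]
    have : ((n : ℝ) + 1) * levyWeight n (sideLength ρ (n + 1)) Ψ m *
        structureFactor n (sideLength ρ (n + 1)) Ψ m =
        levyWeight n (sideLength ρ (n + 1)) Ψ m *
          (((n : ℝ) + 1) * structureFactor n (sideLength ρ (n + 1)) Ψ m) := by ring
    rw [this] at himu
    exact himu
  have hν_def : levyWeight n (sideLength ρ (n + 1)) Ψ m =
      (cellFourierCoeff (sideLength ρ (n + 1)) (fun r : Space => ((Real.log
        (∫ x in cell (sideLength ρ (n + 1)), ∫ Y in cellN n (sideLength ρ (n + 1)),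
          ‖Ψ.ψ (Matrix.vecCons (x + r) Y)‖ * ‖Ψ.ψ (Matrix.vecCons x Y)‖) : ℝ) : ℂ)) m).re := rfl
  rw [← hν_def]
  have hC1 : ∀ lam : ℝ, ContDiff ℝ 1 (fun w : ℂ => -(lam : ℂ) * w) := fun lam =>
    contDiff_const.mul contDiff_id
  have hJ := fun lam : ℝ =>
    steinInline_negLinearField n (sideLength ρ (n + 1)) Ψ m lam (fun w : ℂ => -(lam : ℂ) * w) (fun _ => rfl)
  generalize hA : (∫ X in cellN (n + 1) (sideLength ρ (n + 1)),
      ‖∑ j : Fin (n + 1), cellWave (sideLength ρ (n + 1)) m (X j)‖ ^ 2 * ‖Ψ.ψ X‖ ^ 2) = A at hA0 hνA hJ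
  generalize hν : levyWeight n (sideLength ρ (n + 1)) Ψ m = ν at hνA ⊢
  by_cases hApos : 0 < A
  · refine ⟨fun w => -((2 / A : ℝ) : ℂ) * w, hC1 _, ?_⟩
    rw [hJ, show 4 * (2 / A) - (2 / A) ^ 2 * A = 4 / A by field_simp; ring,
      show (4 * C₀ + 4) * (4 / A) = (16 * (C₀ + 1)) / A by ring, le_div_iff₀ hApos]
    have : 16 * ν * A = 16 * (ν * A) := by ring
    rw [this]
    linarith
  · have hA_eq : A = 0 := le_antisymm (not_lt.mp hApos) hA0
    refine ⟨fun w => -((|ν| : ℝ) : ℂ) * w, hC1 _, ?_⟩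
    rw [hJ, hA_eq]
    simp only [mul_zero, sub_zero]
    nlinarith [le_abs_self ν, abs_nonneg ν, mul_nonneg hC₀ (abs_nonneg ν)]

end Summit.AtomisticToContinuum.BoseEinsteinCondensation.Theorems.InfraredMinimumUncertainty.Negative

end
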